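import Literature.RingTheory.Idempotents.PositiveInvolutionCornerField
import Literature.RingTheory.Idempotents.CentralIdempotents
import Literature.RingTheory.CentralSimple.AlbertTypesNumberField
import Mathlib.RingTheory.Idempotents
import Mathlib.RingTheory.SimpleModule.Basic
import Mathlib.RingTheory.Artinian.Module
import Mathlib.LinearAlgebra.Trace
import Mathlib.LinearAlgebra.FiniteDimensional.Basic
import Mathlib.Algebra.Algebra.Hom.Rat
import Mathlib.Algebra.Module.LinearMap.Rat
import Mathlib.Algebra.Module.Opposite
import Mathlib.NumberTheory.NumberField.Basic
import HarnessLib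

/-!
# The centre of a stable subalgebra under a positive anti-involution: its blocks are fixed and each block is a
# number field with a positive involution (Mumford §21; Shimura §5.1 Prop. 5; Milne CM Prop. 1.36 / 1.39)

D. Mumford, *Abelian Varieties* (1970), §21, proof of Thm. 2 (p. 201): the Rosati involution of `End⁰(X)` «maps the
centre `K` onto itself» and is positive there; J. S. Milne, *Complex Multiplication*, Ch. I Prop. 1.36 «Every
finite-dimensional `ℚ`-algebra admitting a positive involution is semisimple» and Prop. 1.39 (proof, footnote 11:
«for if `B = B₁ × B₂`, then `(a,0)(a,0)' = (a,0)(0,a') = 0`» — a positive involution of a commutative algebra FIXES every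
simple factor); G. Shimura, *Abelian Varieties with Complex Multiplication and Modular Functions* (1998), §5.1
Prop. 5 (p. 38): «Hence we have `Tr_{K/Q}(ξξ') > 0` for every `ξ ≠ 0` in `K`».  Application of record ([Liu2021] App. D,
proof of Thm. D.6 (1), p. 140): `D = End⁰(A_K)` (Jacobian of a unitary Shimura curve) with the Rosati involution of the
canonical polarisation, `H ⊆ D` the image of the Hecke algebra (stable under Rosati because the transpose of the Hecke
correspondence `T(KgK)` is `T(Kg⁻¹K)`), `ε` the block of `H` cut out by an automorphic representation; the block FIELD
`Z(H)·ε` (the Hecke field of the block) then carries a positive involution, hence is totally real or CM (the tree's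
`NumberFields.PositiveInvolution`, `ComplexMultiplication.EndFieldCMOfPositiveInvolutionOverSubfield`).

PURE ALGEBRA.  Data: a finite-dimensional `ℚ`-algebra `D`; a ring anti-endomorphism `τ : D →+* Dᵐᵒᵖ` whose trace form
is POSITIVE, `0 < Tr_ℚ(L_{x·τx} ∣ D)` for `x ≠ 0` (the currency of ★ `PositiveInvolutionCornerField`; NO `τ² = 1` is
needed); a `τ`-STABLE subalgebra `H ⊆ D` (`τ(H) ⊆ H`); a CENTRALLY PRIMITIVE idempotent `ε` of `H` (a block,
`CentralIdempotents.IsCentrallyPrimitive`, as produced by ★ `ArtinianBlockDecomposition.exists_block_decomposition`).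

* §1 `injective_of_trace_mul_pos`, `exists_unop_apply_eq_of_mem` (`τ` maps `H` ONTO `H`), `unop_apply_comm_of_central`
  (`τ` maps the centre `Z(H)` into itself).
* §2 **`unop_apply_eq_self_of_isCentrallyPrimitive`: `τ ε = ε`** for every block `ε` of `H` (Milne's footnote: `τ ε`
  is again a central idempotent of `H`; `ε·τε = 0` would kill the trace form at `ε`, so `ε ≤ τε ≤ τ²ε`, and then
  `(τε - ε)·τ(τε - ε) = 0` forces `τε = ε`).
* §3 `eq_zero_of_isNilpotent_of_central`: the centre `Z(H)` is REDUCED (a nilpotent central `z` has `z·τz` nilpotent,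
  of trace `0`) — no semisimplicity hypothesis on `H` is needed anywhere in this file.
* §4 **`exists_centreBlockField`**: the block `Z(H)·ε` of the centre is a NUMBER FIELD `R₀` — packaged as a type
  `R₀` with `Field`/`NumberField` instances and an injective multiplicative `ℚ`-linear `φ : R₀ → D` with `φ 1 = ε`,
  `φ(R₀) = Z(H)·ε ⊆ H` central in `H` and `τ`-stable — carrying the ring endomorphism `ρ = φ⁻¹ ∘ τ ∘ φ` with
  `0 < Tr_{R₀/ℚ}(r·ρ r)` for `r ≠ 0` (★ `exists_ringHom_trace_mul_pos_of_antiHom`).  This is the `(R₀, ρ)` datum of the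
  cell's S2′ shape `BlockShape′` modulo its two Rosati binders («RosHecke» = `τ(H) ⊆ H`, «RosPos» = positivity).
* §5 `exists_centreBlockField_of_isPositiveAntiInvolution`: the same in the currency `IsPositiveAntiInvolution D ι`
  of `RingTheory/CentralSimple/AlbertTypes` (`ι : D →ₗ[ℚ] D`, `0 < Tr(ι x · x)`).

RELATION TO THE TREE (nothing restated): ★ `RingTheory/CentralSimple/PositiveInvolutionStableSubalgebra` treats a UNITAL commutative
reduced `σ`-stable subalgebra `R ≤ D` of a positive pair `(D, σ)` in the involutive currency `IsPositiveAntiInvolution D σ`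
(`exists_range_eq_of_stable`: `R ≅ ∏ᵢ Lᵢ` with positive factor involutions; `apply_eq_self_of_isIdempotentElem`;
`isSemisimpleRing_subalgebra`).  Here the subalgebra `H` is NOT commutative, the object is ONE BLOCK `Z(H)·ε` of its centre
(a non-unital corner of `D`), `τ` is only an anti-endomorphism with positive trace form (no `τ² = 1`), and the output is
packaged as the cell's S2′ datum: a `NumberField` type `R₀` with `φ`, `ρ` and `0 < Algebra.trace ℚ R₀ (r · ρ r)`.

Theorems only; no definition, no named fact, no instance, no `sorry`.  Count-neutral for the cell `hodgecm-mathlib`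
(HC_CM is proved only modulo the 7 printed citations until rung 0 closes).

## References
* [MumfordAV1970] D. Mumford, *Abelian Varieties* (1970), §21: Thm. 1 (positivity of the Rosati involution) and the
  proof of Thm. 2 (p. 201: the involution on the centre).
* [MilneCM2006] J. S. Milne, *Complex Multiplication* (2006/2020), Ch. I Prop. 1.36, Prop. 1.39 with footnote 11 (pp. 20–21).
* [Shimura1998] G. Shimura, *Abelian Varieties with Complex Multiplication and Modular Functions* (1998), §5.1
  Prop. 5 (p. 38) and Lemma 2.
* [Liu2021] Y. Liu, *Fourier–Jacobi cycles and arithmetic relative trace formula*, Camb. J. Math. 9 (2021), App. D,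
  proof of Thm. D.6 (1) (p. 140).
-/

noncomputable section

namespace Literature.RingTheory.Idempotents

open Module Function

universe u

variable {D : Type u} [Ring D] [Algebra ℚ D] [Module.Finite ℚ D]

/-! ## §1 A positive anti-endomorphism is injective and maps a stable subalgebra onto itself -/

omit [Module.Finite ℚ D] in
/-- A ring anti-endomorphism with positive trace form is injective (`τ x = 0` kills `Tr(L_{x·τx})`).
[cite: MilneCM2006, Ch. I Prop. 1.36 (p. 20)] -/
theorem injective_of_trace_mul_pos (τ : D →+* Dᵐᵒᵖ)
    (hpos : ∀ x : D, x ≠ 0 → 0 < LinearMap.trace ℚ D (Algebra.lmul ℚ D (x * (τ x).unop))) :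
    Function.Injective τ := by
  intro x y hxy
  by_contra hne
  have h := hpos (x - y) (sub_ne_zero.2 hne)
  rw [map_sub, hxy, sub_self, MulOpposite.unop_zero, mul_zero, map_zero, map_zero] at h
  exact lt_irrefl _ h

/-- A positive anti-endomorphism maps a stable subalgebra `H` (`τ(H) ⊆ H`) ONTO `H` (injective endomorphism of a
finite-dimensional space). [cite: MumfordAV1970, §21 proof of Thm. 2 (p. 201)] -/
theorem exists_unop_apply_eq_of_mem (τ : D →+* Dᵐᵒᵖ)
    (hpos : ∀ x : D, x ≠ 0 → 0 < LinearMap.trace ℚ D (Algebra.lmul ℚ D (x * (τ x).unop)))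
    (H : Subalgebra ℚ D) (hH : ∀ x ∈ H, (τ x).unop ∈ H) {y : D} (hy : y ∈ H) :
    ∃ x ∈ H, (τ x).unop = y := by
  -- `u = unop ∘ τ` as a `ℚ`-linear endomorphism of `D`
  let u : D →ₗ[ℚ] D :=
    ((MulOpposite.opLinearEquiv ℚ (M := D)).symm : Dᵐᵒᵖ →ₗ[ℚ] D) ∘ₗ (τ.toRatAlgHom : D →ₐ[ℚ] Dᵐᵒᵖ).toLinearMap
  have hu : ∀ x, u x = (τ x).unop := fun x => rfl
  have huH : ∀ x ∈ H.toSubmodule, u x ∈ H.toSubmodule := fun x hx => by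
    rw [hu]; exact hH x hx
  haveI : FiniteDimensional ℚ H.toSubmodule := inferInstance
  have hinj : Function.Injective (u.restrict huH) := by
    intro a b hab
    apply Subtype.ext
    have h1 : u a = u b := congrArg Subtype.val hab
    rw [hu, hu] at h1
    exact injective_of_trace_mul_pos τ hpos (MulOpposite.unop_injective h1)
  obtain ⟨⟨x, hx⟩, hxy⟩ := (LinearMap.injective_iff_surjective.1 hinj) ⟨y, hy⟩
  refine ⟨x, hx, ?_⟩
  have := congrArg Subtype.val hxy
  simpa [LinearMap.restrict_apply, hu] using this

/-- A positive anti-endomorphism maps the commutant of a stable subalgebra `H` into itself; in particular it maps the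
CENTRE of `H` into the centre of `H` («maps the centre onto itself»). [cite: MumfordAV1970, §21 proof of Thm. 2 (p. 201)] -/
theorem unop_apply_comm_of_central (τ : D →+* Dᵐᵒᵖ)
    (hpos : ∀ x : D, x ≠ 0 → 0 < LinearMap.trace ℚ D (Algebra.lmul ℚ D (x * (τ x).unop)))
    (H : Subalgebra ℚ D) (hH : ∀ x ∈ H, (τ x).unop ∈ H) {z : D}
    (hzc : ∀ y ∈ H, z * y = y * z) : ∀ y ∈ H, (τ z).unop * y = y * (τ z).unop := by
  intro y hy
  obtain ⟨x, hx, rfl⟩ := exists_unop_apply_eq_of_mem τ hpos H hH hy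
  rw [← MulOpposite.unop_mul, ← MulOpposite.unop_mul, ← map_mul, ← map_mul, hzc x hx]

/-! ## §2 The blocks of a stable subalgebra are fixed -/

/-- **A positive anti-endomorphism fixes every block of a stable subalgebra**: `τ ε = ε` for a centrally primitive
idempotent `ε` of `H` (Milne: «case (b) is excluded, for `(a,0)(a,0)' = (a,0)(0,a') = 0`»).
[cite: MilneCM2006, Ch. I proof of Prop. 1.39, footnote 11 (p. 21)] [cite: MumfordAV1970, §21 proof of Thm. 2 (p. 201)] -/
theorem unop_apply_eq_self_of_isCentrallyPrimitive (τ : D →+* Dᵐᵒᵖ)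
    (hpos : ∀ x : D, x ≠ 0 → 0 < LinearMap.trace ℚ D (Algebra.lmul ℚ D (x * (τ x).unop)))
    (H : Subalgebra ℚ D) (hH : ∀ x ∈ H, (τ x).unop ∈ H) {ε : D} (hεH : ε ∈ H)
    (hε : IsCentrallyPrimitive (⟨ε, hεH⟩ : H)) : (τ ε).unop = ε := by
  have hεi : IsIdempotentElem ε := by
    have h := hε.idem.eq
    exact congrArg Subtype.val h
  have hεc : ∀ y ∈ H, ε * y = y * ε := fun y hy => congrArg Subtype.val (hε.comm ⟨y, hy⟩)
  have hε0 : ε ≠ 0 := fun h => hε.ne_zero (Subtype.ext h)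
  -- `ε' = τ ε` is a central idempotent of `H`
  set ε' := (τ ε).unop with hε'def
  have hε'H : ε' ∈ H := hH ε hεH
  have hε'i : IsIdempotentElem ε' := by
    change ε' * ε' = ε'
    rw [hε'def, ← MulOpposite.unop_mul, ← map_mul, hεi.eq]
  have hε'c : ∀ y ∈ H, ε' * y = y * ε' := unop_apply_comm_of_central τ hpos H hH hεc
  -- dichotomy `ε' ε ∈ {0, ε}` (central primitivity of `ε`)
  have hdich : ε' * ε = 0 ∨ ε' * ε = ε := by
    have h := hε.mul_eq_zero_or_eq (z := (⟨ε', hε'H⟩ : H)) (Subtype.ext hε'i.eq)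
      (fun a => Subtype.ext (hε'c a a.2))
    rcases h with h | h
    · exact Or.inl (congrArg Subtype.val h)
    · exact Or.inr (congrArg Subtype.val h)
  rcases hdich with h0 | hε'ε
  · -- `ε · τε = 0` kills the trace form at `ε ≠ 0`
    exfalso
    have h := hpos ε hε0
    rw [← hε'def, hεc ε' hε'H, h0, map_zero, map_zero] at h
    exact lt_irrefl _ h
  · -- `ε ≤ τε ≤ τ²ε`, and then `(τε - ε) · τ(τε - ε) = 0`
    have hεε' : ε * ε' = ε := by rw [hεc ε' hε'H]; exact hε'ε
    set ε'' := (τ ε').unop with hε''def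
    have h2 : ε' * ε'' = ε' := by
      have h := congrArg (fun t => (τ t).unop) hε'ε
      simpa only [map_mul, MulOpposite.unop_mul, ← hε'def, ← hε''def] using h
    have h3 : ε * ε'' = ε := by
      calc ε * ε'' = ε * ε' * ε'' := by rw [hεε']
        _ = ε * (ε' * ε'') := mul_assoc _ _ _
        _ = ε := by rw [h2, hεε']
    by_contra hne
    have hδ0 : ε' - ε ≠ 0 := sub_ne_zero.2 hne
    have h := hpos (ε' - ε) hδ0
    have hzero : (ε' - ε) * (τ (ε' - ε)).unop = 0 := by
      rw [map_sub, MulOpposite.unop_sub, ← hε''def, ← hε'def, sub_mul, mul_sub, mul_sub, h2, hε'i.eq, h3, hεε',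
        sub_self, sub_self, sub_self]
    rw [hzero, map_zero, map_zero] at h
    exact lt_irrefl _ h

/-! ## §3 The centre of a stable subalgebra is reduced -/

omit [Module.Finite ℚ D] in
/-- **No non-zero central nilpotents in a stable subalgebra**: a nilpotent `z ∈ Z(H)` has `z · τz` nilpotent
(`τz ∈ Z(H)` commutes with `z`), so `Tr(L_{z·τz}) = 0` and positivity forces `z = 0` (Milne Prop. 1.36 for the
centre). [cite: MilneCM2006, Ch. I Prop. 1.36 (p. 20)] -/
theorem eq_zero_of_isNilpotent_of_central (τ : D →+* Dᵐᵒᵖ)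
    (hpos : ∀ x : D, x ≠ 0 → 0 < LinearMap.trace ℚ D (Algebra.lmul ℚ D (x * (τ x).unop)))
    (H : Subalgebra ℚ D) (hH : ∀ x ∈ H, (τ x).unop ∈ H) {z : D} (hz : z ∈ H)
    (hzc : ∀ y ∈ H, z * y = y * z) (hn : IsNilpotent z) : z = 0 := by
  by_contra h0
  have hc : Commute z (τ z).unop := hzc _ (hH z hz)
  have hn' : IsNilpotent (z * (τ z).unop) := hc.isNilpotent_mul_right hn
  have htr : LinearMap.trace ℚ D (Algebra.lmul ℚ D (z * (τ z).unop)) = 0 :=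
    (LinearMap.isNilpotent_trace_of_isNilpotent (hn'.map (Algebra.lmul ℚ D))).eq_zero
  have h := hpos z h0
  rw [htr] at h
  exact lt_irrefl _ h

/-! ## §4 The block field `Z(H)·ε` and its positive involution -/

/-- **THE BLOCK FIELD OF THE CENTRE.**  For a positive anti-endomorphism `τ` of `D`, a `τ`-stable subalgebra `H` and a
block `ε` of `H` (centrally primitive idempotent), `Z(H)·ε` is a NUMBER FIELD: there are a number field `R₀` and an
injective multiplicative `ℚ`-linear `φ : R₀ → D` with `φ 1 = ε`, `φ(R₀) = {z ε ∣ z ∈ Z(H)} ⊆ H` central in `H` and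
`τ`-stable, together with the ring endomorphism `ρ = φ⁻¹ ∘ τ ∘ φ` of `R₀` whose trace form is positive,
`0 < Tr_{R₀/ℚ}(r · ρ r)` for `r ≠ 0` («Hence we have `Tr_{K/Q}(ξξ') > 0`»).  Reducedness of `Z(H)ε` comes from
positivity (§3); no semisimplicity of `H` is assumed.
[cite: MumfordAV1970, §21 proof of Thm. 2 (p. 201)] [cite: Shimura1998, §5.1 Proposition 5 (p. 38)]
[cite: MilneCM2006, Ch. I Prop. 1.39 (pp. 20–21)] [cite: Liu2021, App. D, proof of Thm. D.6 (1) (p. 140)] -/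
theorem exists_centreBlockField (τ : D →+* Dᵐᵒᵖ)
    (hpos : ∀ x : D, x ≠ 0 → 0 < LinearMap.trace ℚ D (Algebra.lmul ℚ D (x * (τ x).unop)))
    (H : Subalgebra ℚ D) (hH : ∀ x ∈ H, (τ x).unop ∈ H) {ε : D} (hεH : ε ∈ H)
    (hε : IsCentrallyPrimitive (⟨ε, hεH⟩ : H)) :
    ∃ (R₀ : Type u) (_ : Field R₀) (_ : NumberField R₀) (φ : R₀ →ₗ[ℚ] D),
      Function.Injective φ ∧ (∀ a b : R₀, φ (a * b) = φ a * φ b) ∧ φ 1 = ε ∧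
      (∀ r : R₀, φ r ∈ H) ∧ (∀ r : R₀, ∀ y ∈ H, φ r * y = y * φ r) ∧ (∀ r : R₀, φ r * ε = φ r) ∧
      (∀ z ∈ H, (∀ y ∈ H, z * y = y * z) → ∃ r : R₀, φ r = z * ε) ∧
      (∀ r : R₀, ∃ r' : R₀, (τ (φ r)).unop = φ r') ∧
      ∃ ρ : R₀ →+* R₀, (∀ r : R₀, φ (ρ r) = (τ (φ r)).unop) ∧
        (∀ r : R₀, r ≠ 0 → 0 < Algebra.trace ℚ R₀ (r * ρ r)) ∧
        ∀ r : R₀, 0 ≤ Algebra.trace ℚ R₀ (r * ρ r) := by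
  classical
  -- facts about `ε`
  have hεi : IsIdempotentElem ε := by
    have h := hε.idem.eq
    exact congrArg Subtype.val h
  have hεc : ∀ y ∈ H, ε * y = y * ε := fun y hy => congrArg Subtype.val (hε.comm ⟨y, hy⟩)
  have hε0 : ε ≠ 0 := fun h => hε.ne_zero (Subtype.ext h)
  have hprim : ∀ e : H, IsIdempotentElem e → (∀ a : H, e * a = a * e) → e * ⟨ε, hεH⟩ = e →
      e = 0 ∨ e = ⟨ε, hεH⟩ := (isCentrallyPrimitive_iff.1 hε).2.2.2
  have hτε : (τ ε).unop = ε := unop_apply_eq_self_of_isCentrallyPrimitive τ hpos H hH hεH hε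
  -- the centre `Z = Z(H)` and `ε ∈ Z`
  let Z : Subalgebra ℚ H := Subalgebra.center ℚ H
  let εZ : Z := ⟨⟨ε, hεH⟩, Subalgebra.mem_center_iff.2 fun b => (Subtype.ext (hεc b b.2)).symm⟩
  have hεZ : IsIdempotentElem εZ := Subtype.ext (Subtype.ext hεi.eq)
  -- the block `R₀ = Z·ε`, as the corner ring of `ε` in the commutative ring `Z`
  let R₀ : Type u := hεZ.Corner
  -- the embedding `f : R₀ → D`
  let f : R₀ → D := fun r => (((r.1 : Z) : H) : D)
  have hf_add : ∀ r s : R₀, f (r + s) = f r + f s := fun r s => rfl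
  have hf_mul : ∀ r s : R₀, f (r * s) = f r * f s := fun r s => rfl
  have hf_zero : f 0 = 0 := rfl
  have hf_one : f 1 = ε := rfl
  have hf_inj : Function.Injective f := fun r s h => Subtype.ext (Subtype.ext (Subtype.ext h))
  have hf_mem : ∀ r : R₀, f r ∈ H := fun r => ((r.1 : Z) : H).2
  have hf_central : ∀ r : R₀, ∀ y ∈ H, f r * y = y * f r := fun r y hy => by
    have h := Subalgebra.mem_center_iff.1 (r.1 : Z).2 ⟨y, hy⟩
    exact (congrArg Subtype.val h).symm
  have hf_eps : ∀ r : R₀, f r * ε = f r := fun r => by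
    have h := ((Subsemigroup.mem_corner_iff hεZ).1 r.2).2
    exact congrArg (fun t : Z => ((t : H) : D)) h
  have hf_surj : ∀ z ∈ H, (∀ y ∈ H, z * y = y * z) → ∃ r : R₀, f r = z * ε := by
    intro z hz hzc
    let zZ : Z := ⟨⟨z, hz⟩, Subalgebra.mem_center_iff.2 fun b => (Subtype.ext (hzc b b.2)).symm⟩
    refine ⟨⟨εZ * zZ * εZ, zZ, rfl⟩, ?_⟩
    change ε * z * ε = z * ε
    rw [hεc z hz, mul_assoc, hεi.eq]
  let fAdd : R₀ →+ D := { toFun := f, map_zero' := hf_zero, map_add' := hf_add }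
  -- `R₀` is a field: `Z` is reduced (§3), hence semisimple; an ideal of `Z` is generated by an idempotent, which is
  -- `0` or `ε` on the block
  have hF : IsField R₀ := by
    refine ⟨⟨0, 1, fun h => hε0 ?_⟩, mul_comm, fun {a} ha => ?_⟩
    · have h1 : f 0 = f 1 := congrArg f h
      rw [hf_zero, hf_one] at h1
      exact h1.symm
    · haveI : Module.Finite ℚ H := inferInstanceAs (Module.Finite ℚ H.toSubmodule)
      haveI : Module.Finite ℚ Z := inferInstanceAs (Module.Finite ℚ Z.toSubmodule)
      haveI : IsArtinianRing Z := IsArtinianRing.of_finite ℚ Z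
      haveI : IsReduced Z := ⟨fun z hz => by
        have hn : IsNilpotent (((z : H) : D)) := hz.map ((H.val).comp Z.val)
        have hzc : ∀ y ∈ H, ((z : H) : D) * y = y * ((z : H) : D) := fun y hy => by
          have h := Subalgebra.mem_center_iff.1 z.2 ⟨y, hy⟩
          exact (congrArg Subtype.val h).symm
        have h0 := eq_zero_of_isNilpotent_of_central τ hpos H hH (z : H).2 hzc hn
        exact Subtype.ext (Subtype.ext h0)⟩
      haveI : IsSemisimpleRing Z := IsArtinianRing.isSemisimpleRing_of_isReduced Z
      obtain ⟨x, hx⟩ := a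
      have hxε : x * εZ = x := ((Subsemigroup.mem_corner_iff hεZ).1 hx).2
      obtain ⟨e, he, hspan⟩ := IsSemisimpleRing.ideal_eq_span_idempotent (Ideal.span {x})
      have hex : e ∈ Ideal.span {x} := by rw [hspan]; exact Ideal.mem_span_singleton_self e
      obtain ⟨b, hb⟩ := Ideal.mem_span_singleton'.1 hex
      have heε : e * εZ = e := by rw [← hb, mul_assoc, hxε]
      have hec : ∀ a : H, (e : H) * a = a * (e : H) := fun a =>
        (Subalgebra.mem_center_iff.1 e.2 a).symm
      rcases hprim (e : H) (congrArg Subtype.val he.eq) hec (congrArg Subtype.val heε) with h0 | h1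
      · -- `e = 0`: then `x = 0`
        exfalso
        apply ha
        have he0 : e = 0 := Subtype.ext h0
        have hx0 : x ∈ Ideal.span {e} := by rw [← hspan]; exact Ideal.mem_span_singleton_self x
        rw [he0, Ideal.span_singleton_eq_bot.2 rfl, Ideal.mem_bot] at hx0
        exact Subtype.ext hx0
      · -- `e = ε`: then `ε ∈ Z·x`, i.e. `x` is invertible in the block
        have he1 : e = εZ := Subtype.ext h1
        have hεx : εZ ∈ Ideal.span {x} := by rw [hspan, he1]; exact Ideal.mem_span_singleton_self _
        obtain ⟨c, hc⟩ := Ideal.mem_span_singleton'.1 hεx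
        refine ⟨⟨εZ * c * εZ, c, rfl⟩, Subtype.ext ?_⟩
        change x * (εZ * c * εZ) = εZ
        rw [show x * (εZ * c * εZ) = c * x * (εZ * εZ) by ring, hc, hεZ.eq, hεZ.eq]
  letI : Field R₀ := hF.toField
  -- characteristic zero: `f n = n • ε`
  haveI hchar : CharZero R₀ := by
    refine charZero_of_inj_zero fun n hn => ?_
    have h1 : f (n : R₀) = n • ε := by
      rw [show ((n : R₀)) = n • (1 : R₀) from (nsmul_one n).symm]
      exact (map_nsmul fAdd n (1 : R₀) : _)
    have h2 : (n : ℚ) • ε = 0 := by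
      rw [Nat.cast_smul_eq_nsmul, ← h1, hn, hf_zero]
    rcases smul_eq_zero.1 h2 with h | h
    · exact_mod_cast h
    · exact absurd h hε0
  -- the `ℚ`-linear embedding and finiteness
  let φ : R₀ →ₗ[ℚ] D := fAdd.toRatLinearMap
  have hφf : ∀ r, φ r = f r := fun r => rfl
  have hφ_inj : Function.Injective φ := fun a b h => hf_inj (by rwa [hφf, hφf] at h)
  have hφ_mul : ∀ a b : R₀, φ (a * b) = φ a * φ b := fun a b => by rw [hφf, hφf, hφf]; exact hf_mul a b
  haveI : FiniteDimensional ℚ R₀ := FiniteDimensional.of_injective φ hφ_inj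
  haveI : NumberField R₀ := @NumberField.mk R₀ _ hchar inferInstance
  -- `τ`-stability of `φ(R₀) = Z·ε`: `τ(a ε) = τ(ε) τ(a) = ε τ(a)` with `τ a ∈ Z(H)` (§1, §2)
  have hstab : ∀ r : R₀, ∃ r' : R₀, (τ (φ r)).unop = φ r' := by
    intro r
    obtain ⟨a, ha⟩ := r.2
    have hfr : f r = ((a : H) : D) * ε := by
      change (((r.1 : Z) : H) : D) = _
      rw [← ha]
      change ε * ((a : H) : D) * ε = _
      rw [hεc _ (a : H).2, mul_assoc, hεi.eq]
    have haH : ((a : H) : D) ∈ H := (a : H).2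
    have hac : ∀ y ∈ H, ((a : H) : D) * y = y * ((a : H) : D) := fun y hy => by
      have h := Subalgebra.mem_center_iff.1 a.2 ⟨y, hy⟩
      exact (congrArg Subtype.val h).symm
    have hτaH : (τ ((a : H) : D)).unop ∈ H := hH _ haH
    have hτac := unop_apply_comm_of_central τ hpos H hH hac
    obtain ⟨r', hr'⟩ := hf_surj _ hτaH hτac
    refine ⟨r', ?_⟩
    rw [hφf, hφf, hr', hfr, map_mul, MulOpposite.unop_mul, hτε]
    exact (hτac ε hεH).symm
  -- the positive involution `ρ = φ⁻¹ τ φ` (★ `PositiveInvolutionCornerField`)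
  obtain ⟨ρ, hρφ, hρpos, hρnn⟩ := exists_ringHom_trace_mul_pos_of_antiHom τ hpos φ hφ_mul hφ_inj hstab
  refine ⟨R₀, inferInstance, inferInstance, φ, hφ_inj, hφ_mul, hf_one, hf_mem, hf_central, hf_eps, ?_, hstab, ρ, hρφ,
    hρpos, hρnn⟩
  intro z hz hzc
  obtain ⟨r, hr⟩ := hf_surj z hz hzc
  exact ⟨r, hr⟩

/-! ## §5 The same in the currency `IsPositiveAntiInvolution` -/

open Literature.RingTheory.CentralSimple in
/-- **The block field of the centre, for a positive anti-involution `ι : D →ₗ[ℚ] D`** (`(xy)' = y'x'`, `x'' = x`,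
`0 < Tr(x'x)`; the tree's `IsPositiveAntiInvolution`): for an `ι`-stable subalgebra `H` and a block `ε` of `H`, the
number field `R₀ ≅ Z(H)·ε` with its positive involution `ρ`, `φ ∘ ρ = ι ∘ φ`.
[cite: MumfordAV1970, §21 Thm. 1 and proof of Thm. 2 (p. 201)] [cite: MilneCM2006, Ch. I Prop. 1.39 (pp. 20–21)]
[cite: Shimura1998, §5.1 Proposition 5 (p. 38)] -/
theorem exists_centreBlockField_of_isPositiveAntiInvolution {ι : D →ₗ[ℚ] D} (hι : IsPositiveAntiInvolution D ι)
    (H : Subalgebra ℚ D) (hH : ∀ x ∈ H, ι x ∈ H) {ε : D} (hεH : ε ∈ H)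
    (hε : IsCentrallyPrimitive (⟨ε, hεH⟩ : H)) :
    ι ε = ε ∧
    ∃ (R₀ : Type u) (_ : Field R₀) (_ : NumberField R₀) (φ : R₀ →ₗ[ℚ] D),
      Function.Injective φ ∧ (∀ a b : R₀, φ (a * b) = φ a * φ b) ∧ φ 1 = ε ∧
      (∀ r : R₀, φ r ∈ H) ∧ (∀ r : R₀, ∀ y ∈ H, φ r * y = y * φ r) ∧ (∀ r : R₀, φ r * ε = φ r) ∧
      (∀ z ∈ H, (∀ y ∈ H, z * y = y * z) → ∃ r : R₀, φ r = z * ε) ∧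
      (∀ r : R₀, ∃ r' : R₀, ι (φ r) = φ r') ∧
      ∃ ρ : R₀ →+* R₀, (∀ r : R₀, φ (ρ r) = ι (φ r)) ∧
        (∀ r : R₀, r ≠ 0 → 0 < Algebra.trace ℚ R₀ (r * ρ r)) ∧
        ∀ r : R₀, 0 ≤ Algebra.trace ℚ R₀ (r * ρ r) := by
  -- `ι` as a ring anti-endomorphism `τ : D →+* Dᵐᵒᵖ`
  let τ : D →+* Dᵐᵒᵖ :=
    { toFun := fun x => MulOpposite.op (ι x)
      map_one' := by rw [hι.map_one]; rfl
      map_mul' := fun x y => by rw [hι.map_mul]; rfl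
      map_zero' := by rw [map_zero]; rfl
      map_add' := fun x y => by rw [map_add]; rfl }
  have hτ : ∀ x, (τ x).unop = ι x := fun x => rfl
  -- positivity `0 < Tr(L_{x·ιx}) = Tr(L_{ιx·x})`
  have hpos : ∀ x : D, x ≠ 0 → 0 < LinearMap.trace ℚ D (Algebra.lmul ℚ D (x * (τ x).unop)) := by
    intro x hx
    have h := hι.trace_pos x hx
    rw [Literature.NumberTheory.Automorphic.leftMulTrace_apply, map_mul, LinearMap.trace_mul_comm, ← map_mul] at h
    rwa [hτ]
  have hH' : ∀ x ∈ H, (τ x).unop ∈ H := fun x hx => hH x hx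
  refine ⟨unop_apply_eq_self_of_isCentrallyPrimitive τ hpos H hH' hεH hε, ?_⟩
  obtain ⟨R₀, _, _, φ, h1, h2, h3, h4, h5, h6, h7, h8, ρ, h9, h10, h11⟩ := exists_centreBlockField τ hpos H hH' hεH hε
  exact ⟨R₀, inferInstance, inferInstance, φ, h1, h2, h3, h4, h5, h6, h7, h8, ρ, h9, h10, h11⟩

end Literature.RingTheory.Idempotents

end
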